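import Summits.Schanuel.Schanuel.Theses.MatrixCoefficients
import Summits.Schanuel.Schanuel.Theorems.RootDecomp1DeterminantalPlacement
import Literature.Barriers.Schanuel.AlgebraicIndependenceOfLogarithmsRankProofs
import Literature.NumberTheory.Transcendental.BakerCoefficientForm
import Summits.Schanuel.Schanuel.Statement
import HarnessLib

/-!
# RootDecomp1 — the MATRIX-COEFFICIENT LADDER on piece D (graded by the pencil size `n`) · part 01 of 2
(part 01 = §1–§5: the uniform sieve, exact reach, the forcing lemma, Baker's floor rung; part 02 = §6: the
explicit grade-4 member `k3Pencil`, imports this file)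
(cell decomp-schanuel · lens-1 «grading / quantitative ladder» · g22 · route `route-Schanuel-RootDecomp1`,
piece D = `DisjointSaturatedEssentialSchanuel`, stmt-Schanuel-30353; ONE registered input, used for the first
time on this route: `Summit.Schanuel.Schanuel.Theses.MatrixCoefficients.MatrixCoefficient` = stmt-Schanuel-15349,
Dasgupta–Kakde's Matrix Coefficient Conjecture for ALL sizes `n` — open, printed, strictly inside the log sector;
its `n = 3` layer `MatrixCoefficientThree` = stmt-Schanuel-15346 drove lens-1 g21 `RootDecomp1IsotropySieve`)

Piece D's v4 residue in degree `n` begins with Cell(n−1, 0): a `ℚ`-linearly independent `n`-tuple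
`z ∈ 𝓛ⁿ` (`𝓛 = logQSpan`, logarithms of algebraic numbers) carrying exactly one algebraic relation, on a
locus that is NOT unirational (unirational loci are the scope of `RationalImageSchanuel`, stmt-29644, where D
is vacuous).  This file makes lens-1 g21's isotropy sieve UNIFORM IN THE GRADE `n` and reads off the exact
reach of the Matrix Coefficient Conjecture (MCC) on `ℚ`-DETERMINANTAL such loci
`{det (X₀A₀ + ⋯ + X_{n-1}A_{n-1}) = 0}`, `Aₖ ∈ M_N(ℚ)`:

* §1–§2 `det_ne_zero_of_mccAt` — **the sieve at grade `n` (`N = n`).**  If the rational tensor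
  `A = (A₀, …, A_{n−1})`, `Aₖ ∈ Mₙ(ℚ)`, has NO RATIONAL ISOTROPIC PAIR (`wᵗAₖv = 0 ∀ k ⇒ w = 0 ∨ v = 0`),
  then MCC at size `n` alone implies: no `ℚ`-linearly independent `z ∈ 𝓛ⁿ` lies on the degree-`n` cone
  `det (∑ zₖAₖ) = 0` (`wᵗ(∑ zₖAₖ)v = ∑ₖ (wᵗAₖv) zₖ` is a RATIONAL relation, `bilinear_sum_smul_eq`).
  `det_ne_zero_of_mcc` is the same from the all-`n` item stmt-15349; the tree's g21 theorem
  `RootDecomp1IsotropySieve.det_ne_zero_of_mc3` is literally the `n = 3` instance (from stmt-15346).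
* §3 `isotropicPair_of_ratPoint`, `ratPoint_of_isotropicPair` — **exact reach, uniformly in `n`** (square
  case `N = n`): a rational isotropic pair exists iff the cone has a non-zero RATIONAL POINT.  So at grade
  `n` the sieve empties exactly the `ℚ`-determinantal degree-`n` cones in `n` variables WITHOUT rational
  points, i.e. (for smooth members) cones over POINTLESS `ℚ`-determinantal hypersurfaces of degree `n` in
  `ℙ^{n−1}` — anticanonical degree: two conjugate points (`n = 2`), plane cubics of genus one (`n = 3`, g21),
  quartic K3 surfaces (`n = 4`), quintic Calabi–Yau threefolds (`n = 5`), …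
* §4 `isotropicPair_of_lt` — **the grading is sharp on the size axis**: for `n`-pencils of `N × N`
  rational matrices with `n < N` a rational isotropic pair ALWAYS exists (`w = e₀`; the `n` rows `e₀ᵗAₖ`
  have a common null vector in `ℚᴺ`), so MCC at size `N` says nothing about cones of degree `N > n` in `n`
  variables; and for `N < n` the degree-`N` determinantal cones are unirational (swept by the linear spaces
  `{x : L(x)v = 0}`, `v ∈ ℙ^{N−1}`) — `RationalImageSchanuel`'s scope, where D is vacuous (recorded in
  the docstrings only; no Lean claim).  Hence the MCC-decidable part of D's residue is EXACTLY the diagonal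
  `N = n`: one Calabi–Yau stratum per grade.
* §5 `grade_two_free_of_baker` — **the floor rung is a theorem**: at `n = 2` the statement «no
  `ℚ`-linearly independent pair in `𝓛²` on a `ℚ`-determinantal binary quadric cone without isotropic pair»
  holds UNCONDITIONALLY, by the tree's Baker theorem in coefficient form (`baker_coeff_eq_zero`): the
  binary form factors over `ℚ̄` and either factor is a `ℚ̄`-linear relation.
* §6 — **an explicit grade-4 member decided modulo MCC₄.**  `k3Pencil`:
  `L(X) = [[X₀, −X₃, X₂, X₁], [−X₁, X₀+X₃, −X₂+X₃, X₁+X₂], [X₂, −X₁, X₀−X₃, X₂+X₃], [X₃, X₂, −X₁, X₀+X₃]]`,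
  a signed integer lift of the regular representation of `𝔽₁₆ = 𝔽₂[θ]/(θ⁴+θ+1)` (`Aₖ ≡ M_{θᵏ} (mod 2)`), so
  `F = det L ≡ Norm_{𝔽₁₆/𝔽₂} (mod 2)` is ANISOTROPIC mod 2 (`mcQuartic_zmod_two`, `decide`) and the cone
  `F = 0` has no non-zero rational point (`int_descent`, `rat_descent`, `k3Cone_no_ratPoint`); hence no
  isotropic pair (`no_isotropic_pair_k3Pencil`, via §3) and (`k3Cone_free_of_mccFour`) MCC AT SIZE 4 ALONE
  empties this cell: no `ℚ`-linearly independent quadruple of logarithms of algebraic numbers lies on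
  `F = 0`; D and Schanuel's inequality hold there vacuously (`schanuel_ineq_on_k3Cone_of_mcc`).
  `F = X₀⁴ + X₀³X₃ − X₀²X₁X₂ − 2X₀²X₂² − X₀²X₃² + X₀X₁³ + X₀X₁X₂X₃ + X₀X₁X₃² − X₀X₂³ + X₀X₂²X₃ − X₀X₃³ + X₁⁴
  + X₁²X₂X₃ − 2X₁²X₃² + 3X₁X₂³ + 3X₁X₃³ + X₂⁴ + X₂X₃³ + X₃⁴` (`mcQuartic`).  PAPER-LEVEL (certified outside
  Lean, lens folder g22/compute/k3pencil-certificate.json): the Jacobian ideal of `F` has the complete-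
  intersection Hilbert function `16, 19, 16, 10, 4, 1, 0` in degrees `3…9` (exact rank mod two primes), so
  `V(F) ⊂ ℙ³` is a SMOOTH quartic surface — a K3 surface, not uniruled, a fortiori not unirational: the cell
  lies in D's genuine residue (outside stmt-29644's scope), in the second storey (`n = 4`) above g21's
  elliptic cones; `V(F)(ℝ) ≠ ∅`, `V(F)(ℚ₂) = ∅`.
* `k3Cone_free_of_schanuel` — S-side pin: Schanuel's conjecture empties the same cell (tree
  `algIndepLogarithms_of_schanuel`; `F(1,0,0,0) = 1 ≠ 0`), so the decided statement is on-path.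

Honest label (NODE-g22): per grade `n`, a DECISION of an explicit sub-class of D's Cell(n−1,0) residue
MODULO ONE registered open statement below `S` (MCC at size `n`; all sizes = stmt-15349), unconditional only
at `n = 2`; unconditional content = the uniform sieve/reach/forcing lemmas, Baker's floor rung and the
arithmetic of the explicit K3 pencil.  MCC and `Schanuel` occur only as hypotheses; no `Prop` definitions,
no instances, no notation, no axioms.
-/

namespace Summit.Schanuel.Schanuel.Theorems.RootDecomp1MCLadder

open Literature.Barriers.Schanuel
open Summit.Schanuel.Schanuel.Theses.MatrixCoefficients (MatrixCoefficient)
open Summit.Schanuel.Schanuel.Theorems.RootDecomp1DeterminantalPlacement (sum_smul_map_mem_logQSpan)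
open Literature.NumberTheory.Transcendental (baker_coeff_eq_zero)

/-! ## §1 The bilinear form of a rational pencil at a point of `𝓛ⁿ` (entries in `𝓛`: tree `sum_smul_map_mem_logQSpan`) -/

/-- `wᵗ (∑ₖ zₖ Aₖ) v = ∑ₖ (wᵗ Aₖ v) • zₖ` for rational `w, v` and an `n`-pencil of rational `N × N`
matrices: the matrix coefficient of a member of a rational pencil is a RATIONAL linear form in the pencil
coordinates (uniform in `n` and `N`). [folklore] -/
theorem bilinear_sum_smul_eq {n N : ℕ} (A : Fin n → Matrix (Fin N) (Fin N) ℚ) (z : Fin n → ℂ)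
    (w v : Fin N → ℚ) :
    ∑ i, ∑ j, (w i : ℂ) * (∑ k, z k • (A k).map (algebraMap ℚ ℂ)) i j * (v j : ℂ) =
      ∑ k, (∑ i, ∑ j, w i * A k i j * v j : ℚ) • z k := by
  simp only [Matrix.sum_apply, Matrix.smul_apply, Matrix.map_apply, smul_eq_mul, eq_ratCast,
    Rat.smul_def]
  push_cast
  simp only [Finset.mul_sum, Finset.sum_mul]
  calc ∑ i, ∑ j, ∑ k, (w i : ℂ) * (z k * ((A k i j : ℚ) : ℂ)) * (v j : ℂ)
      = ∑ i, ∑ k, ∑ j, (w i : ℂ) * (z k * ((A k i j : ℚ) : ℂ)) * (v j : ℂ) :=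
        Finset.sum_congr rfl fun i _ => Finset.sum_comm
    _ = ∑ k, ∑ i, ∑ j, (w i : ℂ) * (z k * ((A k i j : ℚ) : ℂ)) * (v j : ℂ) := Finset.sum_comm
    _ = ∑ k, ∑ i, ∑ j, (w i : ℂ) * ((A k i j : ℚ) : ℂ) * (v j : ℂ) * z k :=
        Finset.sum_congr rfl fun k _ => Finset.sum_congr rfl fun i _ =>
          Finset.sum_congr rfl fun j _ => by ring

/-! ## §2 The sieve at grade `n` -/

/-- **MATRIX-COEFFICIENT SIEVE AT GRADE `n`.**  Let `A₀, …, A_{n−1} ∈ Mₙ(ℚ)` have no rational isotropic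
pair.  Then the Matrix Coefficient Conjecture AT SIZE `n` (hypothesis `hMCn`, the size-`n` layer of
stmt-Schanuel-15349) implies that no `ℚ`-linearly independent `z ∈ ℂⁿ` with every `e^{zₖ}` algebraic lies
on the degree-`n` cone `det (∑ zₖ Aₖ) = 0`: `M = ∑ zₖ Aₖ` has entries in `𝓛`, so MCC gives non-zero rational
`w, v` with `wᵗMv = ∑ₖ (wᵗAₖv) zₖ = 0`, and the `ℚ`-linear independence of `z` forces `wᵗAₖv = 0` for
every `k`. [cite: DasguptaKakde2024, Conjecture 1.2] -/
theorem det_ne_zero_of_mccAt {n : ℕ}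
    (hMCn : ∀ M : Matrix (Fin n) (Fin n) ℂ, (∀ i j, IsAlgebraic ℚ (Complex.exp (M i j))) → M.det = 0 →
      ∃ w v : Fin n → ℚ, w ≠ 0 ∧ v ≠ 0 ∧ ∑ i, ∑ j, (w i : ℂ) * M i j * (v j : ℂ) = 0)
    (A : Fin n → Matrix (Fin n) (Fin n) ℚ)
    (hA : ∀ w v : Fin n → ℚ, (∀ k, ∑ i, ∑ j, w i * A k i j * v j = 0) → w = 0 ∨ v = 0)
    (z : Fin n → ℂ) (hz : LinearIndependent ℚ z) (halg : ∀ k, IsAlgebraic ℚ (Complex.exp (z k))) :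
    (∑ k, z k • (A k).map (algebraMap ℚ ℂ)).det ≠ 0 := by
  intro hdet
  have hentry : ∀ i j,
      IsAlgebraic ℚ (Complex.exp ((∑ k, z k • (A k).map (algebraMap ℚ ℂ)) i j)) :=
    fun i j => isAlgebraic_cexp_of_mem_logQSpan (sum_smul_map_mem_logQSpan halg A i j)
  obtain ⟨w, v, hw, hv, hsum⟩ := hMCn _ hentry hdet
  rw [bilinear_sum_smul_eq] at hsum
  have hcoef := Fintype.linearIndependent_iff.mp hz _ hsum
  rcases hA w v (fun k => hcoef k) with h | h
  · exact hw h
  · exact hv h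

/-- The sieve from the registered all-sizes item `MatrixCoefficient` (stmt-Schanuel-15349), at any grade
`n`. [cite: DasguptaKakde2024, Conjecture 1.2] -/
theorem det_ne_zero_of_mcc (hMC : MatrixCoefficient) {n : ℕ} (A : Fin n → Matrix (Fin n) (Fin n) ℚ)
    (hA : ∀ w v : Fin n → ℚ, (∀ k, ∑ i, ∑ j, w i * A k i j * v j = 0) → w = 0 ∨ v = 0)
    (z : Fin n → ℂ) (hz : LinearIndependent ℚ z) (halg : ∀ k, IsAlgebraic ℚ (Complex.exp (z k))) :
    (∑ k, z k • (A k).map (algebraMap ℚ ℂ)).det ≠ 0 :=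
  det_ne_zero_of_mccAt (hMC n) A hA z hz halg

/-- Vacuous corollary in the format of piece D / the summit, at grade `n`: under MCC at size `n`,
Schanuel's inequality holds at every `ℚ`-linearly independent `n`-tuple of logarithms of algebraic numbers
on such a cone (there is none). [cite: DasguptaKakde2024, Conjecture 1.2] -/
theorem schanuel_ineq_on_cone_of_mccAt {n : ℕ}
    (hMCn : ∀ M : Matrix (Fin n) (Fin n) ℂ, (∀ i j, IsAlgebraic ℚ (Complex.exp (M i j))) → M.det = 0 →
      ∃ w v : Fin n → ℚ, w ≠ 0 ∧ v ≠ 0 ∧ ∑ i, ∑ j, (w i : ℂ) * M i j * (v j : ℂ) = 0)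
    (A : Fin n → Matrix (Fin n) (Fin n) ℚ)
    (hA : ∀ w v : Fin n → ℚ, (∀ k, ∑ i, ∑ j, w i * A k i j * v j = 0) → w = 0 ∨ v = 0)
    (z : Fin n → ℂ) (hz : LinearIndependent ℚ z) (halg : ∀ k, IsAlgebraic ℚ (Complex.exp (z k)))
    (hcone : (∑ k, z k • (A k).map (algebraMap ℚ ℂ)).det = 0) :
    (n : Cardinal) ≤ Algebra.trdeg ℚ
      ↥(IntermediateField.adjoin ℚ (Set.range z ∪ Set.range (Complex.exp ∘ z))) :=
  absurd hcone (det_ne_zero_of_mccAt hMCn A hA z hz halg)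

/-! ## §3 Exact reach, uniformly in the grade: isotropic pairs = rational points (square case `N = n`) -/

/-- If the cone `det (∑ xₖ Aₖ) = 0` (`n` rational `n × n` matrices) has a non-zero RATIONAL point `x`, then
`A` has a rational isotropic pair: take `v ≠ 0` in the kernel of `∑ xₖ Aₖ`; the `n` vectors `Aₖ v ∈ ℚⁿ`
satisfy the non-trivial relation `∑ xₖ (Aₖ v) = 0`, so some `w ≠ 0` is orthogonal to all of them.  (On
such tensors MCC's conclusion holds trivially and the sieve is void.) [folklore] -/
theorem isotropicPair_of_ratPoint {n : ℕ} (A : Fin n → Matrix (Fin n) (Fin n) ℚ) (x : Fin n → ℚ)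
    (hx : x ≠ 0) (hdet : (∑ k, x k • A k).det = 0) :
    ∃ w v : Fin n → ℚ, w ≠ 0 ∧ v ≠ 0 ∧ ∀ k, ∑ i, ∑ j, w i * A k i j * v j = 0 := by
  obtain ⟨v, hv, hMv⟩ := Matrix.exists_mulVec_eq_zero_iff.2 hdet
  -- `C k i = (Aₖ v) i`; the relation `∑ₖ xₖ (Aₖ v) = (∑ xₖ Aₖ) v = 0` says `xᵗ C = 0`.
  have hxC : Matrix.vecMul x (Matrix.of fun k i => (A k).mulVec v i) = 0 := by
    funext i
    calc Matrix.vecMul x (Matrix.of fun k i => (A k).mulVec v i) i = (∑ k, x k • A k).mulVec v i := by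
          simp only [Matrix.vecMul, Matrix.mulVec, dotProduct, Matrix.of_apply, Matrix.sum_apply,
            Matrix.smul_apply, smul_eq_mul, Finset.mul_sum, Finset.sum_mul]
          exact Finset.sum_comm.trans
            (Finset.sum_congr rfl fun j _ => Finset.sum_congr rfl fun k _ => by ring)
      _ = 0 := by rw [hMv]; rfl
  have hCdet : (Matrix.of fun k i => (A k).mulVec v i).det = 0 :=
    Matrix.exists_vecMul_eq_zero_iff.1 ⟨x, hx, hxC⟩
  obtain ⟨w, hw, hCw⟩ := Matrix.exists_mulVec_eq_zero_iff.2 hCdet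
  refine ⟨w, v, hw, hv, fun k => ?_⟩
  calc ∑ i, ∑ j, w i * A k i j * v j = (Matrix.of fun k i => (A k).mulVec v i).mulVec w k := by
        simp only [Matrix.mulVec, dotProduct, Matrix.of_apply, Finset.sum_mul]
        exact Finset.sum_congr rfl fun i _ => Finset.sum_congr rfl fun j _ => by ring
    _ = 0 := by rw [hCw]; rfl

/-- Conversely, a rational isotropic pair `(w, v)` yields a non-zero rational point of the cone: the `n`
row vectors `wᵗ Aₖ ∈ ℚⁿ` are orthogonal to `v ≠ 0`, hence linearly dependent, `∑ xₖ wᵗAₖ = 0` with `x ≠ 0`,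
and then `wᵗ (∑ xₖ Aₖ) = 0` with `w ≠ 0` forces `det (∑ xₖ Aₖ) = 0`.  So at every grade the sieve reaches
EXACTLY the `ℚ`-determinantal cones without rational points. [folklore] -/
theorem ratPoint_of_isotropicPair {n : ℕ} (A : Fin n → Matrix (Fin n) (Fin n) ℚ) (w v : Fin n → ℚ)
    (hw : w ≠ 0) (hv : v ≠ 0) (hiso : ∀ k, ∑ i, ∑ j, w i * A k i j * v j = 0) :
    ∃ x : Fin n → ℚ, x ≠ 0 ∧ (∑ k, x k • A k).det = 0 := by
  -- `R k j = (wᵗ Aₖ) j`; isotropy says `R v = 0`.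
  have hRv : (Matrix.of fun k j => Matrix.vecMul w (A k) j).mulVec v = 0 := by
    funext k
    calc (Matrix.of fun k j => Matrix.vecMul w (A k) j).mulVec v k = ∑ i, ∑ j, w i * A k i j * v j := by
          simp only [Matrix.mulVec, Matrix.vecMul, dotProduct, Matrix.of_apply, Finset.sum_mul]
          exact Finset.sum_comm
      _ = 0 := hiso k
  have hRdet : (Matrix.of fun k j => Matrix.vecMul w (A k) j).det = 0 :=
    Matrix.exists_mulVec_eq_zero_iff.1 ⟨v, hv, hRv⟩
  obtain ⟨x, hx, hxR⟩ := Matrix.exists_vecMul_eq_zero_iff.2 hRdet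
  refine ⟨x, hx, Matrix.exists_vecMul_eq_zero_iff.1 ⟨w, hw, ?_⟩⟩
  funext j
  calc Matrix.vecMul w (∑ k, x k • A k) j
        = Matrix.vecMul x (Matrix.of fun k j => Matrix.vecMul w (A k) j) j := by
        simp only [Matrix.vecMul, dotProduct, Matrix.of_apply, Matrix.sum_apply, Matrix.smul_apply,
          smul_eq_mul, Finset.mul_sum]
        exact Finset.sum_comm.trans
          (Finset.sum_congr rfl fun k _ => Finset.sum_congr rfl fun i _ => by ring)
    _ = 0 := by rw [hxR]; rfl

/-! ## §4 The size axis: `n < N` forces an isotropic pair -/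

/-- **FORCING LEMMA.**  An `n`-pencil of rational `N × N` matrices with `n < N` ALWAYS has a rational
isotropic pair: with `w = e₀` the `n` row vectors `e₀ᵗ Aₖ ∈ ℚᴺ` have a common non-zero null vector `v`
(pad the `n × N` matrix of these rows by zero rows to an `N × N` matrix; its determinant vanishes).  So MCC
at size `N` is void on cones of degree `N > n` in `n` variables: the sieve lives on the diagonal `N = n`.
[folklore] -/
theorem isotropicPair_of_lt {n N : ℕ} (hnN : n < N) (A : Fin n → Matrix (Fin N) (Fin N) ℚ) :
    ∃ w v : Fin N → ℚ, w ≠ 0 ∧ v ≠ 0 ∧ ∀ k, ∑ i, ∑ j, w i * A k i j * v j = 0 := by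
  have hN : 0 < N := lt_of_le_of_lt (Nat.zero_le n) hnN
  -- the padded square matrix of the rows `e₀ᵗ Aₖ = (Aₖ) 0`
  let R : Matrix (Fin N) (Fin N) ℚ :=
    Matrix.of fun i j => if h : (i : ℕ) < n then A ⟨i, h⟩ ⟨0, hN⟩ j else 0
  have hRdet : R.det = 0 :=
    Matrix.det_eq_zero_of_row_eq_zero ⟨n, hnN⟩ fun j => by simp [R]
  obtain ⟨v, hv, hRv⟩ := Matrix.exists_mulVec_eq_zero_iff.2 hRdet
  refine ⟨Pi.single ⟨0, hN⟩ 1, v, ?_, hv, fun k => ?_⟩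
  · intro h0
    have := congrFun h0 ⟨0, hN⟩
    simp at this
  · have hk : R.mulVec v ⟨k, k.2.trans hnN⟩ = 0 := by rw [hRv]; rfl
    have hrow : ∀ j, R ⟨k, k.2.trans hnN⟩ j = A k ⟨0, hN⟩ j := fun j => by
      simp [R, k.2]
    rw [Finset.sum_eq_single ⟨0, hN⟩ (fun i _ hi => by simp [hi])
      (fun h => absurd (Finset.mem_univ _) h)]
    simp only [Pi.single_eq_same, one_mul]
    simpa only [Matrix.mulVec, dotProduct, hrow] using hk

/-! ## §5 The floor rung `n = 2` is a theorem (Baker) -/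

/-- **GRADE 2, UNCONDITIONALLY.**  Let `A₀, A₁ ∈ M₂(ℚ)` have no rational isotropic pair.  Then NO
`ℚ`-linearly independent pair `z ∈ ℂ²` of logarithms of algebraic numbers lies on the binary quadric cone
`det (z₀A₀ + z₁A₁) = 0` — by Baker's theorem (tree, coefficient form `baker_coeff_eq_zero`): the form is
`α z₀² + β z₀z₁ + γ z₁²` with `α = det A₀ ≠ 0` (else `(1, 0)` is a rational point, `isotropicPair_of_ratPoint`);
with a root `t ∈ ℚ̄` of `αT² + βT + γ` it factors as `(z₀ − t z₁)(α z₀ + (α t + β) z₁)`, and either factor is a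
non-trivial `ℚ̄`-linear relation between `z₀` and `z₁`.  This is the `n = 2` rung of the ladder (two
conjugate points = the anticanonical hypersurface of `ℙ¹`), where MCC is not needed.
[cite: Baker1975, Theorem 2.1] -/
theorem grade_two_free_of_baker (A : Fin 2 → Matrix (Fin 2) (Fin 2) ℚ)
    (hA : ∀ w v : Fin 2 → ℚ, (∀ k, ∑ i, ∑ j, w i * A k i j * v j = 0) → w = 0 ∨ v = 0)
    (z : Fin 2 → ℂ) (hz : LinearIndependent ℚ z) (halg : ∀ k, IsAlgebraic ℚ (Complex.exp (z k))) :
    (∑ k, z k • (A k).map (algebraMap ℚ ℂ)).det ≠ 0 := by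
  -- the binary quadratic form `det (x₀A₀ + x₁A₁) = α x₀² + β x₀x₁ + γ x₁²`
  set α : ℚ := A 0 0 0 * A 0 1 1 - A 0 0 1 * A 0 1 0 with hα
  set γ : ℚ := A 1 0 0 * A 1 1 1 - A 1 0 1 * A 1 1 0 with hγ
  set β : ℚ := A 0 0 0 * A 1 1 1 + A 1 0 0 * A 0 1 1 - A 0 0 1 * A 1 1 0 - A 1 0 1 * A 0 1 0 with hβ
  have hdetQ : ∀ x : Fin 2 → ℚ,
      (∑ k, x k • A k).det = α * x 0 ^ 2 + β * (x 0 * x 1) + γ * x 1 ^ 2 := by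
    intro x
    simp only [Matrix.det_fin_two, Fin.sum_univ_two, Matrix.add_apply, Matrix.smul_apply, smul_eq_mul,
      hα, hβ, hγ]
    ring
  have hdetC : (∑ k, z k • (A k).map (algebraMap ℚ ℂ)).det =
      (α : ℂ) * z 0 ^ 2 + (β : ℂ) * (z 0 * z 1) + (γ : ℂ) * z 1 ^ 2 := by
    simp only [Matrix.det_fin_two, Fin.sum_univ_two, Matrix.add_apply, Matrix.smul_apply,
      Matrix.map_apply, smul_eq_mul, eq_ratCast, hα, hβ, hγ]
    push_cast
    ring
  -- `α ≠ 0`: otherwise `x = (1, 0)` is a rational point of the cone and an isotropic pair exists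
  have hα0 : α ≠ 0 := by
    intro h0
    have hne : (![1, 0] : Fin 2 → ℚ) ≠ 0 := fun h => by simpa using congrFun h 0
    have hpt : (∑ k, (![1, 0] : Fin 2 → ℚ) k • A k).det = 0 := by
      rw [hdetQ]; simp [h0]
    obtain ⟨w, v, hw, hv, hiso⟩ := isotropicPair_of_ratPoint A _ hne hpt
    rcases hA w v hiso with h | h
    · exact hw h
    · exact hv h
  intro hdet
  rw [hdetC] at hdet
  -- a root `t` of `α T² + β T + γ` in `ℂ`, algebraic over `ℚ`
  set p : Polynomial ℚ :=
    Polynomial.C α * Polynomial.X ^ 2 + Polynomial.C β * Polynomial.X + Polynomial.C γ with hp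
  have hpdeg : p.degree = 2 := Polynomial.degree_quadratic hα0
  have hp0 : p ≠ 0 := by
    intro h
    rw [h, Polynomial.degree_zero] at hpdeg
    exact absurd hpdeg (by decide)
  obtain ⟨t, ht⟩ := IsAlgClosed.exists_aeval_eq_zero ℂ p (by rw [hpdeg]; decide)
  have htalg : IsAlgebraic ℚ t := ⟨p, hp0, ht⟩
  have ht' : (α : ℂ) * t ^ 2 + (β : ℂ) * t + (γ : ℂ) = 0 := by
    simpa [hp, map_add, map_mul] using ht
  -- the relation factors
  have hprod : (z 0 - t * z 1) * ((α : ℂ) * z 0 + ((α : ℂ) * t + β) * z 1) = 0 := by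
    linear_combination hdet - z 1 ^ 2 * ht'
  have hαC : IsAlgebraic ℚ (α : ℂ) := by simpa using isAlgebraic_algebraMap (R := ℚ) (A := ℂ) α
  have hβC : IsAlgebraic ℚ (β : ℂ) := by simpa using isAlgebraic_algebraMap (R := ℚ) (A := ℂ) β
  rcases mul_eq_zero.mp hprod with h1 | h2
  · -- `1 · z₀ + (−t) · z₁ = 0`: Baker forces the coefficient `1` to vanish
    have hB := baker_coeff_eq_zero z halg hz (β₀ := 0) (β := ![1, -t]) isAlgebraic_zero
      (fun i => by
        fin_cases i
        · simpa using isAlgebraic_one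
        · simpa using htalg.neg)
      (by simp [Fin.sum_univ_two]; linear_combination h1)
    have h10 := hB.2 0
    simp at h10
  · -- `α · z₀ + (α t + β) · z₁ = 0`: Baker forces `α = 0`
    have hB := baker_coeff_eq_zero z halg hz (β₀ := 0) (β := ![(α : ℂ), (α : ℂ) * t + β])
      isAlgebraic_zero
      (fun i => by
        fin_cases i
        · simpa using hαC
        · simpa using (hαC.mul htalg).add hβC)
      (by simp [Fin.sum_univ_two]; linear_combination h2)
    have h10 := hB.2 0
    simp only [Matrix.cons_val_zero, Rat.cast_eq_zero] at h10
    exact hα0 h10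

end Summit.Schanuel.Schanuel.Theorems.RootDecomp1MCLadder
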